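import Summits.AtomisticToContinuum.Crystallization.Theorems.PalmUnimodularRigidityMinimiserShellsResidual
import Summits.AtomisticToContinuum.Crystallization.Theorems.PalmUnimodularRigidityMinimiserShellsNecessityBlocks
import Summits.AtomisticToContinuum.Crystallization.Theorems.PalmUnimodularRigidityMinimiserShellsMuGSCBasics
import Summits.AtomisticToContinuum.Crystallization.Theorems.PalmUnimodularRigidityMinimiserShellsDeepBadPricingOfShellNoBoundary
import Summits.AtomisticToContinuum.Crystallization.Theorems.PalmUnimodularRigidityMinimiserShellsSepQualShellNoBoundaryOfSepPeriodicShellGap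
import Summits.AtomisticToContinuum.Crystallization.Theorems.PalmUnimodularRigidityCruxesToPalmRigidity
import Literature.Geometry.DiscreteGeometry.KissingPatterns
import Summits.AtomisticToContinuum.Crystallization.Theorems.PalmUnimodularRigidityMinimiserShellsLooseGoodShellMeasurable
import Summits.AtomisticToContinuum.Crystallization.Theorems.PalmUnimodularRigidityMinimiserShellsSepQualLooseGap
import Summits.AtomisticToContinuum.Crystallization.Theorems.PalmUnimodularRigidityMinimiserShellsAeLooseGoodShell
import Summits.AtomisticToContinuum.Crystallization.Theorems.PalmUnimodularRigidityMinimiserShellsPatternCovering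
import Summits.AtomisticToContinuum.Crystallization.Theorems.PalmUnimodularRigidityMinimiserShellsBoundaryShell
import Summits.AtomisticToContinuum.Crystallization.Theorems.PalmUnimodularRigidityMinimiserShellsShellGapConjecture

/-!
# Line `elastic-coarse-to-fine` — crux `MinimiserShells` (stmt-AtomisticToContinuum-9225), skeleton r6
# (r5 with its ONE open stub carried BY NAME: `stub_lennardJonesShellGapConjecture : LennardJonesShellGapConjecture`)

**r6 (lead c18, 2026-08-17).**  r5 (lead c15) left exactly one `sorry`, `stub_shellGapAll : ∀ θ ∈ (0, 1/10], ShellGap θ`,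
and c15–c17 certified it EQUIVALENT to the crux (`ExactResidual.minimiserShells_iff_shellGapAll`, p149424) and gave it a
name in the tree, the `@[conjecture]` definition `Summit.AtomisticToContinuum.Crystallization.LennardJonesShellGapConjecture`
(`Theorems/PalmUnimodularRigidityMinimiserShellsShellGapConjecture.lean`, p154555, with
`minimiserShells_iff_lennardJonesShellGapConjecture : MinimiserShells ↔ LennardJonesShellGapConjecture`).  r6 changes
nothing in the composition; it only moves the `sorry` onto that NAMED declaration, so the registered stub list of this
crux reads, literally, "the Lennard-Jones hard-core periodic first-shell gap conjecture" (bulk 3-D Lennard-Jones 12-6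
crystallization in loosened periodic first-shell form; Blanc–Lewin 2015 §2.3: open), and r5's `stub_shellGapAll` becomes
the derived, sorry-free `shellGapAll_of_stub`.  Two read-backs are added at the end: `MinimiserShells_proof'` (the crux
from the named stub in one step, via the landed glue `minimiserShells_of_lennardJonesShellGapConjecture`) and
`minimiserShells_iff_stub` (the crux ↔ the stub's statement, landed).  Nothing below the stub is missing or open.

r5 header (lead `prover-line-stmt-AtomisticToContinuum-9225-c15`, 2026-08-17, reshaping r4 (c12–c14)) follows unchanged,
except that "Stub 1" is now the named conjecture.

r4 carried the open core at `θ₀ = 1/20` (`stub_coarseShellGap = ShellGap (1/20)`, certified necessary) and paid for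
that weakening with an XL `e*`-free elastic stub (`stub_clusterCoercivity`: chart at 6 % slack + uniform coercivity
of the Lennard-Jones energy with tail around every relaxed Barlow stacking), handed back `promote-stub` by c12 and
judged beyond worker AND seat size by c13/c14.  r5 takes the limiting member `θ₀ → 0⁺` of the same family of cuts
(STRATEGY-CENSUS §Decomposition: "any θ₀ ∈ (0, 1/10] is admissible"):

* **Stub 1 `stub_shellGapAll` — OPEN CORE, now EXACTLY the crux.**  `∀ θ ∈ (0, 1/10], ShellGap θ`.  Certified
  necessary for EVERY such `θ` (`Residual.shellGap_of_minimiserShells`, p123347), so with stubs 2–6 (all provable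
  now, `e*`-free, no elasticity) the sandwich closes to an EQUIVALENCE
  `MinimiserShells ↔ ∀ θ ∈ (0, 1/10], ShellGap θ`: the crux IS the loosened hard-core periodic first-shell gap
  for 3-D Lennard-Jones — no "closed tolerance boundary" caveat left.  Bulk 3-D LJ crystallization (Blanc–Lewin
  2015 §2.3): open; carried declared as such.
* **Stub 2 `stub_looseGoodShellMeasurable`** (S5 at the loosened predicate): the `θ`-loosely-good-shell event is
  Giry-measurable modulo the hard core.  Mechanical adaptation of `GoodShellMeasurable` (tolerance `a/100 + θ`,
  radius `(5/4 − θ)·a`).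
* **Stub 3 `stub_sepQualLooseGap`** (S16 at the loosened predicate): `ShellGap θ` (periodic, `1/3`-separated)
  gives the finite no-boundary loose gap on `1/3`-separated finite configurations (periodise; locality of the loose
  predicate, `NecessityBlocks.looseGood_congr_of_local`).
* **Stub 4 `stub_aeLooseGoodShell`** (S11 + S8b at the loosened predicate): from stubs 2 and 3, every minimising
  point-stationary hard-core law has a.s. a `θ`-LOOSELY good root shell (threshold pricing of deep loosely-bad sites on
  windows of the a.s. `e*`-`μ`GSC class — `1/3`-separated by `VolumeGrowth.Basics.le_dist` — is affine pricing; the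
  landed slack event transfer `SlackEventTransfer.stub_slackEventTransfer` bounds the event by `t` for every `t`).
* **Stub 5 `stub_patternCovering`** (pure geometry of the two kissing patterns): every direction of `ℝ³` is within
  `45°` of a point of the (rotated) FCC and of the (rotated) HCP kissing pattern: `‖u‖² ≤ 2⟪u, A p⟫²`, `⟪u, A p⟫ ≥ 0`.
* **Stub 6 `stub_boundaryShell`** (the BOUNDARY LEMMA, pointwise, no energy): if the root shell of a hard-core
  configuration `S ∋ 0` is `1/(n+10)`-loosely good for every `n` AND the shell of every atom is `1/100`-loosely good,
  then the root shell is EXACTLY good.  Proof: the matching data are finite, so one matching recurs for infinitely many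
  `n`; the admissible `(a, L)` form a decreasing sequence of non-empty closed subsets of the compact
  `[9/10, 1] × Iso(ℝ³)` — a common point gives an `a/100`-matching of the twelve atoms of the OPEN ball `‖w‖ < 5a/4` and
  no atom in `5a/4 < ‖w‖`… except possibly ON the sphere `‖w‖ = 5a/4`; such a 13th atom `k` is within `0.91a` of a
  matched atom `y` (stub 5: `‖k − a·A p‖ ≤ 0.9a`), and then `k − y` and `−y` are both atoms of the `1/100`-loosely good
  shell of `y`, forcing `‖k − y‖ ≥ 0.948a` — contradiction.  (This is the event c14 believed "only an energetic argument
  could null"; the neighbours' shells null it geometrically, and point-stationarity supplies the neighbours: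
  `PalmUnimodularRigidity.ae_forall_map_sub_of_ae`, landed.)

Composition `MinimiserShells_of` (kernel-checked, sorry-free over the six stubs): for a minimising point-stationary
`δ`-hard-core law, stub 4 (fed by 1, 2, 3) at every level `θ_n = 1/(n+10)` gives a.s. all loose tests at the root;
at level `1/100` the landed root-to-every-atom transport gives them at every atom; stub 6 (fed by 5) concludes
`GoodShell` a.s., i.e. the crux (`LoadBearing.minimiserShells_iff`).

Disproof used (`Cruxes/MinimiserShells/Disproof.lean`, gens 1–3): §2a/§2b/§6/§9 — entry is still only through the
periodic shell gap (all hypotheses consumed upstream in the landed S1/S8a machinery); §2c (no pointwise energy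
certificate) — stub 6 is pointwise but PURELY GEOMETRIC (no energy), and its hypotheses are a.s. consequences of the
loosened gaps; §4b/§5/§8 — no slack / linear pricing constant is claimed anywhere (threshold gaps only).
-/

noncomputable section

open MeasureTheory
open scoped ENNReal BigOperators Classical

namespace Summit.AtomisticToContinuum.Crystallization.Cruxes.MinimiserShells.ElasticCoarseToFine

open Literature.Probability.Process (IsPointStationaryLaw IsRootedHardCore count_restrict_singleton_ne_zero_iff
  map_sub_count_restrict)
open Literature.MathematicalPhysics.StatisticalMechanics (lennardJones interactionEnergy PeriodicConfiguration)
open Literature.Geometry.DiscreteGeometry (ShellCloseTo fccKissingPattern hcpKissingPattern)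
open Summit.AtomisticToContinuum.Crystallization.Theses.PalmUnimodularRigidity (MinimiserShells)
open Summit.AtomisticToContinuum.Crystallization.Theorems.MinimiserShells.Negative.LoadBearing
  (eStar GoodShell meanRootEnergy minimiserShells_iff)
open Summit.AtomisticToContinuum.Crystallization.Theorems.MinimiserShells.Negative.Rootedness (E3)
open Summit.AtomisticToContinuum.Crystallization.Theorems.PalmUnimodularRigidityMinimiserShells.Residual
  (ShellGap LooseGoodShell shellGap_of_minimiserShells)
open Summit.AtomisticToContinuum.Crystallization.Theorems.PalmUnimodularRigidity
  (ae_forall_map_sub_of_ae count_restrict_floorNorm_preimage_lt_top)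

/-! ## The registered stubs (r6: stub 1 = the NAMED conjecture, the only `sorry`; stubs 2–6 LANDED — p149149, p149087, p148931, p149085, p149015 (+ part p148506)) -/

/-- **Stub 1 (THE OPEN CORE, BY NAME) — the Lennard-Jones hard-core periodic first-shell gap conjecture**
(`@[conjecture] def Summit.AtomisticToContinuum.Crystallization.LennardJonesShellGapConjecture`, p154555): for every
loosening `θ ∈ (0, 1/10]` and every `t > 0` some `κ > 0` makes every periodic configuration of `ℝ³` with
`1/3`-separated points and at least `t·#motif` motif sites failing the `θ`-loosened shell test (tolerance
`a/100 + θ`, radius `(5/4 − θ)·a`, scale `a ∈ [9/10, 1]`, FCC or HCP kissing pattern after a linear isometry) have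
`e_LJ(Q) ≥ (⨅_R e_LJ(R)) + κ`.  KERNEL-CERTIFIED EQUIVALENT TO THE CRUX
(`minimiserShells_iff_lennardJonesShellGapConjecture`, p154555 ← p149424 / p123347): no proof of `MinimiserShells` can
avoid it and nothing else is missing.  It is bulk three-dimensional Lennard-Jones 12-6 crystallization in (arbitrarily
finely loosened) periodic first-shell form (Blanc–Lewin 2015 §2.3: "completely open in dimension three"); the line does
not pretend otherwise.  This is the ONLY `sorry` of the skeleton. -/
theorem stub_lennardJonesShellGapConjecture :
    Summit.AtomisticToContinuum.Crystallization.LennardJonesShellGapConjecture := by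
  sorry

/-- r5's stub 1 in residual vocabulary, `∀ θ ∈ (0, 1/10], ShellGap θ`, now DERIVED (sorry-free) from the named stub by the
landed unfolding `lennardJonesShellGapConjecture_iff_shellGapAll` (p154555). -/
theorem shellGapAll_of_stub : ∀ θ : ℝ, 0 < θ → θ ≤ 1 / 10 → ShellGap θ :=
  lennardJonesShellGapConjecture_iff_shellGapAll.1 stub_lennardJonesShellGapConjecture

/-- **Stub 2 — the loosely-good-shell event is Giry-measurable modulo the hard core** (S5 at the loosened
predicate): for `θ ≥ 0` some measurable set of configurations agrees with `LooseGoodShell θ` on every rooted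
`δ`-hard-core counting measure, every `δ > 0`. -/
theorem stub_looseGoodShellMeasurable :
    ∀ θ : ℝ, 0 ≤ θ →
      ∃ B : Set (Measure (EuclideanSpace ℝ (Fin 3))), MeasurableSet B ∧
        ∀ δ : ℝ, 0 < δ → ∀ μ : Measure (EuclideanSpace ℝ (Fin 3)), IsRootedHardCore δ μ →
          (μ ∈ B ↔ LooseGoodShell θ μ) :=
  -- LANDED p149149
  Summit.AtomisticToContinuum.Crystallization.Theorems.PalmUnimodularRigidityMinimiserShells.LooseGoodShellMeasurable.stub_looseGoodShellMeasurable

/-- **Stub 3 — the loosened hard-core periodic shell gap gives the loosened hard-core finite no-boundary gap**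
(S16 at the loosened predicate): for `θ ≥ 0`, `ShellGap θ` implies that for every `t > 0` some `κ > 0` makes every
finite injective `1/3`-separated `y : Fin N → ℝ³` with at least `t·N` indices whose shell (read in `range y − y i`)
is `θ`-loosely bad satisfy `N·(e* + κ) ≤ 𝓔_N(y)`. -/
theorem stub_sepQualLooseGap :
    ∀ θ : ℝ, 0 ≤ θ → ShellGap θ →
      ∀ t : ℝ, 0 < t → ∃ κ : ℝ, 0 < κ ∧
        ∀ (N : ℕ) (y : Fin N → EuclideanSpace ℝ (Fin 3)), Function.Injective y →
          (∀ i j : Fin N, i ≠ j → (1 : ℝ) / 3 ≤ dist (y i) (y j)) →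
          t * (N : ℝ) ≤ (Nat.card {i : Fin N // ¬ LooseGoodShell θ
              ((Measure.count : Measure (EuclideanSpace ℝ (Fin 3))).restrict
                ((fun z => z - y i) '' Set.range y))} : ℝ) →
          (N : ℝ) * (eStar + κ) ≤ interactionEnergy lennardJones y :=
  -- LANDED p149087
  Summit.AtomisticToContinuum.Crystallization.Theorems.PalmUnimodularRigidityMinimiserShells.SepQualLooseGap.stub_sepQualLooseGap

/-- **Stub 4 — a.s. loosely good root shell** (S11 + S8b at the loosened predicate): for `θ ≥ 0`, if the
`θ`-loosely-good event is measurable modulo the hard core (stub 2) and the loosened hard-core finite no-boundary gap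
holds (conclusion of stub 3), then every minimising point-stationary hard-core probability law has almost surely a
`θ`-loosely good root shell. -/
theorem stub_aeLooseGoodShell :
    ∀ θ : ℝ, 0 ≤ θ →
      (∃ B : Set (Measure (EuclideanSpace ℝ (Fin 3))), MeasurableSet B ∧
        ∀ δ : ℝ, 0 < δ → ∀ μ : Measure (EuclideanSpace ℝ (Fin 3)), IsRootedHardCore δ μ →
          (μ ∈ B ↔ LooseGoodShell θ μ)) →
      (∀ t : ℝ, 0 < t → ∃ κ : ℝ, 0 < κ ∧
        ∀ (N : ℕ) (y : Fin N → EuclideanSpace ℝ (Fin 3)), Function.Injective y →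
          (∀ i j : Fin N, i ≠ j → (1 : ℝ) / 3 ≤ dist (y i) (y j)) →
          t * (N : ℝ) ≤ (Nat.card {i : Fin N // ¬ LooseGoodShell θ
              ((Measure.count : Measure (EuclideanSpace ℝ (Fin 3))).restrict
                ((fun z => z - y i) '' Set.range y))} : ℝ) →
          (N : ℝ) * (eStar + κ) ≤ interactionEnergy lennardJones y) →
      ∀ δ : ℝ, 0 < δ → ∀ P : Measure (Measure (EuclideanSpace ℝ (Fin 3))), IsProbabilityMeasure P →
        (∀ᵐ μ ∂P, IsRootedHardCore δ μ) → IsPointStationaryLaw P → meanRootEnergy P ≤ eStar →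
        ∀ᵐ μ ∂P, LooseGoodShell θ μ :=
  -- LANDED p148931
  Summit.AtomisticToContinuum.Crystallization.Theorems.PalmUnimodularRigidityMinimiserShells.AeLooseGoodShell.stub_aeLooseGoodShell

/-- **Stub 5 — covering radius `45°` of the kissing patterns**: for every linear isometry `A` of `ℝ³` and every
vector `u`, some point `p` of the FCC pattern and some point of the HCP pattern (twelve unit vectors each) satisfy
`‖u‖² ≤ 2⟪u, A p⟫²` with `⟪u, A p⟫ ≥ 0` (i.e. the angle between `u` and `A p` is at most `45°`). -/
theorem stub_patternCovering :
    ∀ (A : EuclideanSpace ℝ (Fin 3) →ₗᵢ[ℝ] EuclideanSpace ℝ (Fin 3)) (u : EuclideanSpace ℝ (Fin 3)),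
      (∃ p ∈ fccKissingPattern, ‖u‖ ^ 2 ≤ 2 * (inner ℝ u (A p)) ^ 2 ∧ 0 ≤ inner ℝ u (A p)) ∧
      (∃ p ∈ hcpKissingPattern, ‖u‖ ^ 2 ≤ 2 * (inner ℝ u (A p)) ^ 2 ∧ 0 ≤ inner ℝ u (A p)) :=
  -- LANDED p149085
  Summit.AtomisticToContinuum.Crystallization.Theorems.PalmUnimodularRigidityMinimiserShells.PatternCovering.stub_patternCovering

/-- **Stub 6 — the BOUNDARY LEMMA** (pointwise, purely geometric): granted the covering property of stub 5, if
`S ∋ 0` is `δ`-separated (`δ > 0`), the root shell of `count|S` is `1/(n+10)`-loosely good for every `n : ℕ`, and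
the shell of EVERY atom `y ∈ S` (read in `count|(S − y)`) is `1/100`-loosely good, then the root shell is good in the
crux's exact sense (`GoodShell`: scale `a ∈ [9/10, 1]`, the atoms of the CLOSED ball `‖w‖ ≤ 5a/4` are twelve and
`a/100`-matched to the rotated `a`-scaled FCC or HCP pattern). -/
theorem stub_boundaryShell :
    (∀ (A : EuclideanSpace ℝ (Fin 3) →ₗᵢ[ℝ] EuclideanSpace ℝ (Fin 3)) (u : EuclideanSpace ℝ (Fin 3)),
      (∃ p ∈ fccKissingPattern, ‖u‖ ^ 2 ≤ 2 * (inner ℝ u (A p)) ^ 2 ∧ 0 ≤ inner ℝ u (A p)) ∧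
      (∃ p ∈ hcpKissingPattern, ‖u‖ ^ 2 ≤ 2 * (inner ℝ u (A p)) ^ 2 ∧ 0 ≤ inner ℝ u (A p))) →
    ∀ δ : ℝ, 0 < δ → ∀ S : Set (EuclideanSpace ℝ (Fin 3)), (0 : EuclideanSpace ℝ (Fin 3)) ∈ S →
      (∀ x ∈ S, ∀ z ∈ S, x ≠ z → δ ≤ dist x z) →
      (∀ n : ℕ, LooseGoodShell (1 / ((n : ℝ) + 10))
        ((Measure.count : Measure (EuclideanSpace ℝ (Fin 3))).restrict S)) →
      (∀ y ∈ S, LooseGoodShell (1 / 100)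
        ((Measure.count : Measure (EuclideanSpace ℝ (Fin 3))).restrict ((fun z => z - y) '' S))) →
      GoodShell ((Measure.count : Measure (EuclideanSpace ℝ (Fin 3))).restrict S) :=
  -- LANDED p149015
  Summit.AtomisticToContinuum.Crystallization.Theorems.PalmUnimodularRigidityMinimiserShells.BoundaryShell.stub_boundaryShell

/-! ## Composition (kernel-checked; sorries only inside the stubs) -/

/-- **`MinimiserShells_of` — the line concludes the crux BY NAME from its six stubs.**  For a minimising
point-stationary `δ`-hard-core law: stub 4 (fed by stubs 1, 2, 3) gives, for every level `θ_n = 1/(n+10)`, an a.s.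
`θ_n`-loosely good root shell, hence a.s. all of them at once; at level `1/100 = θ_90` the landed root-to-every-atom
transport (`PalmUnimodularRigidity.ae_forall_map_sub_of_ae`, locally finite by the hard core) makes every atom's shell
`1/100`-loosely good a.s.; stub 6 (fed by stub 5) turns this into an exactly good root shell. -/
theorem MinimiserShells_of
    (h₁ : ∀ θ : ℝ, 0 < θ → θ ≤ 1 / 10 → ShellGap θ)
    (h₂ : ∀ θ : ℝ, 0 ≤ θ →
      ∃ B : Set (Measure (EuclideanSpace ℝ (Fin 3))), MeasurableSet B ∧
        ∀ δ : ℝ, 0 < δ → ∀ μ : Measure (EuclideanSpace ℝ (Fin 3)), IsRootedHardCore δ μ →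
          (μ ∈ B ↔ LooseGoodShell θ μ))
    (h₃ : ∀ θ : ℝ, 0 ≤ θ → ShellGap θ →
      ∀ t : ℝ, 0 < t → ∃ κ : ℝ, 0 < κ ∧
        ∀ (N : ℕ) (y : Fin N → EuclideanSpace ℝ (Fin 3)), Function.Injective y →
          (∀ i j : Fin N, i ≠ j → (1 : ℝ) / 3 ≤ dist (y i) (y j)) →
          t * (N : ℝ) ≤ (Nat.card {i : Fin N // ¬ LooseGoodShell θ
              ((Measure.count : Measure (EuclideanSpace ℝ (Fin 3))).restrict
                ((fun z => z - y i) '' Set.range y))} : ℝ) →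
          (N : ℝ) * (eStar + κ) ≤ interactionEnergy lennardJones y)
    (h₄ : ∀ θ : ℝ, 0 ≤ θ →
      (∃ B : Set (Measure (EuclideanSpace ℝ (Fin 3))), MeasurableSet B ∧
        ∀ δ : ℝ, 0 < δ → ∀ μ : Measure (EuclideanSpace ℝ (Fin 3)), IsRootedHardCore δ μ →
          (μ ∈ B ↔ LooseGoodShell θ μ)) →
      (∀ t : ℝ, 0 < t → ∃ κ : ℝ, 0 < κ ∧
        ∀ (N : ℕ) (y : Fin N → EuclideanSpace ℝ (Fin 3)), Function.Injective y →
          (∀ i j : Fin N, i ≠ j → (1 : ℝ) / 3 ≤ dist (y i) (y j)) →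
          t * (N : ℝ) ≤ (Nat.card {i : Fin N // ¬ LooseGoodShell θ
              ((Measure.count : Measure (EuclideanSpace ℝ (Fin 3))).restrict
                ((fun z => z - y i) '' Set.range y))} : ℝ) →
          (N : ℝ) * (eStar + κ) ≤ interactionEnergy lennardJones y) →
      ∀ δ : ℝ, 0 < δ → ∀ P : Measure (Measure (EuclideanSpace ℝ (Fin 3))), IsProbabilityMeasure P →
        (∀ᵐ μ ∂P, IsRootedHardCore δ μ) → IsPointStationaryLaw P → meanRootEnergy P ≤ eStar →
        ∀ᵐ μ ∂P, LooseGoodShell θ μ)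
    (h₅ : ∀ (A : EuclideanSpace ℝ (Fin 3) →ₗᵢ[ℝ] EuclideanSpace ℝ (Fin 3)) (u : EuclideanSpace ℝ (Fin 3)),
      (∃ p ∈ fccKissingPattern, ‖u‖ ^ 2 ≤ 2 * (inner ℝ u (A p)) ^ 2 ∧ 0 ≤ inner ℝ u (A p)) ∧
      (∃ p ∈ hcpKissingPattern, ‖u‖ ^ 2 ≤ 2 * (inner ℝ u (A p)) ^ 2 ∧ 0 ≤ inner ℝ u (A p)))
    (h₆ : (∀ (A : EuclideanSpace ℝ (Fin 3) →ₗᵢ[ℝ] EuclideanSpace ℝ (Fin 3)) (u : EuclideanSpace ℝ (Fin 3)),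
        (∃ p ∈ fccKissingPattern, ‖u‖ ^ 2 ≤ 2 * (inner ℝ u (A p)) ^ 2 ∧ 0 ≤ inner ℝ u (A p)) ∧
        (∃ p ∈ hcpKissingPattern, ‖u‖ ^ 2 ≤ 2 * (inner ℝ u (A p)) ^ 2 ∧ 0 ≤ inner ℝ u (A p))) →
      ∀ δ : ℝ, 0 < δ → ∀ S : Set (EuclideanSpace ℝ (Fin 3)), (0 : EuclideanSpace ℝ (Fin 3)) ∈ S →
        (∀ x ∈ S, ∀ z ∈ S, x ≠ z → δ ≤ dist x z) →
        (∀ n : ℕ, LooseGoodShell (1 / ((n : ℝ) + 10))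
          ((Measure.count : Measure (EuclideanSpace ℝ (Fin 3))).restrict S)) →
        (∀ y ∈ S, LooseGoodShell (1 / 100)
          ((Measure.count : Measure (EuclideanSpace ℝ (Fin 3))).restrict ((fun z => z - y) '' S))) →
        GoodShell ((Measure.count : Measure (EuclideanSpace ℝ (Fin 3))).restrict S)) :
    MinimiserShells := by
  rw [minimiserShells_iff]
  intro δ hδ P hP hcore hstat hE
  -- every loosened test passes a.s. at the root
  have hn : ∀ n : ℕ, ∀ᵐ μ ∂P, LooseGoodShell (1 / ((n : ℝ) + 10)) μ := by
    intro n
    have hθ0 : (0 : ℝ) < 1 / ((n : ℝ) + 10) := by positivity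
    have hθ1 : 1 / ((n : ℝ) + 10) ≤ 1 / 10 :=
      one_div_le_one_div_of_le (by norm_num) (by linarith [(Nat.cast_nonneg n : (0 : ℝ) ≤ n)])
    exact h₄ _ hθ0.le (h₂ _ hθ0.le) (h₃ _ hθ0.le (h₁ _ hθ0 hθ1)) δ hδ P hP hcore hstat hE
  have hall : ∀ᵐ μ ∂P, ∀ n : ℕ, LooseGoodShell (1 / ((n : ℝ) + 10)) μ := ae_all_iff.2 hn
  -- level `1/100`, transported to every atom
  have h100 : ∀ᵐ μ ∂P, LooseGoodShell (1 / 100) μ := by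
    have h := hn 90
    have he : (1 : ℝ) / ((90 : ℕ) + 10 : ℝ) = 1 / 100 := by norm_num
    simpa only [he] using h
  have hlf : ∀ᵐ μ ∂P, ∀ n : ℕ, μ ((fun z : EuclideanSpace ℝ (Fin 3) => ⌊‖z‖⌋₊) ⁻¹' {n}) < ⊤ := by
    filter_upwards [hcore] with μ hμ n
    obtain ⟨S, -, hsep, rfl⟩ := hμ
    exact count_restrict_floorNorm_preimage_lt_top hδ hsep n
  have hatoms : ∀ᵐ μ ∂P, ∀ y : EuclideanSpace ℝ (Fin 3), μ {y} ≠ 0 →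
      LooseGoodShell (1 / 100) (Measure.map (fun z => z - y) μ) :=
    ae_forall_map_sub_of_ae hstat hlf h100
  -- the boundary lemma, pointwise
  filter_upwards [hcore, hall, hatoms] with μ hμ hallμ hatμ
  obtain ⟨S, h0, hsep, rfl⟩ := hμ
  refine h₆ h₅ δ hδ S h0 hsep hallμ fun y hy => ?_
  have h := hatμ y ((count_restrict_singleton_ne_zero_iff S y).2 hy)
  rwa [map_sub_count_restrict] at h

/-- The same composition fed by the registered stubs, so the audit sees the crux proved modulo exactly
`stub_lennardJonesShellGapConjecture` (the open core, by name; read in residual vocabulary through `shellGapAll_of_stub`)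
and the five landed stubs. -/
theorem MinimiserShells_proof : MinimiserShells :=
  MinimiserShells_of shellGapAll_of_stub stub_looseGoodShellMeasurable stub_sepQualLooseGap stub_aeLooseGoodShell
    stub_patternCovering stub_boundaryShell

/-- **r6 read-back 1 — the crux from the named stub in ONE step**, through the landed glue
`minimiserShells_of_lennardJonesShellGapConjecture` (p154555; itself `ExactResidual.minimiserShells_of_shellGapAll`, p149424,
i.e. exactly the composition `MinimiserShells_of` above with stubs 2–6 instantiated by their landed proofs). -/
theorem MinimiserShells_proof' : MinimiserShells :=
  minimiserShells_of_lennardJonesShellGapConjecture stub_lennardJonesShellGapConjecture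

/-- **r6 read-back 2 — the stub IS the crux** (landed, sorry-free, p154555): whoever settles
`stub_lennardJonesShellGapConjecture` either way settles stmt-AtomisticToContinuum-9225 the same way. -/
theorem minimiserShells_iff_stub :
    MinimiserShells ↔ Summit.AtomisticToContinuum.Crystallization.LennardJonesShellGapConjecture :=
  minimiserShells_iff_lennardJonesShellGapConjecture

/-- **Read-back of what r5 buys once stubs 2–6 land: the crux is EQUIVALENT to its open core** (necessity is the
landed `Residual.shellGap_of_minimiserShells`, p123347). -/
theorem minimiserShells_iff_shellGapAll_of
    (hsuff : (∀ θ : ℝ, 0 < θ → θ ≤ 1 / 10 → ShellGap θ) → MinimiserShells) :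
    MinimiserShells ↔ ∀ θ : ℝ, 0 < θ → θ ≤ 1 / 10 → ShellGap θ :=
  ⟨fun h _ hθ hθ' => shellGap_of_minimiserShells h hθ hθ', hsuff⟩

end Summit.AtomisticToContinuum.Crystallization.Cruxes.MinimiserShells.ElasticCoarseToFine

end
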